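import Summits.BirchSwinnertonDyer.Rank1Residual.ManinAdditive.TowerUnitTwist
import Summits.BirchSwinnertonDyer.Rank1Residual.ManinAdditive.KatoCurvePlusDefectProofs
import Literature.NumberTheory.EllipticCurves.KatoAdditiveTwistedValueNeronIntegralitySymbolClosure
import Literature.NumberTheory.EllipticCurves.SkinnerUrban2014.PAdicUnitPeriodRatioAnyPrimeProofs
import Literature.NumberTheory.Automorphic.ShimuraCurveRibetTakahashiOptimalModularityProofs
import Literature.NumberTheory.EllipticCurves.ModularCurveManinSemistableBridgeProofs
import HarnessLib

/-!
# Kato–Néron integrality at `3` (`KatoFactThreeAt`) is MONOTONE IN THE 3-ADIC SIZE OF THE TWO NÉRON PERIODS — the `p = 3` twin of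
# `…KatoFactTwoAtPeriodRatio.lean` (route `ManinLocalTwoThree`, cell bsd-f2-manin; crux C3 `ManinPrimeToThreeAtNine`
# stmt-BirchSwinnertonDyer-22968; LEAD seat p1 gen 13)

THE POINT.  `KatoFactThreeAt V f` (the body of F₃ / F-es-18♭K at one member `V` of the class of `f`) has two halves: for EVEN `χ` the
twisted values are `3`-integral in units of the REAL period `Ω⁺(V) = realPeriodRat`, for ODD `χ` in units of the IMAGINARY period
`Ω⁻(V) = imaginaryPeriodRat`.  Hence it passes from `V′` to any isogenous globally minimal `V` whose two periods are `3`-adically NOT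
LARGER: `q·Ω⁺(V′) = m·Ω⁺(V)` and `q′·Ω⁻(V′) = m′·Ω⁻(V)` with `3 ∤ q`, `3 ∤ q′` (`m, m′ ∈ ℤ`).  The proof is the `p = 2` transfer
(`katoFactTwoAt_of_isIsogenous_of_realPeriod_ratio`, lead p1 g13) run once per parity: `ϖ′ = ϖ·q/m`, `(s·|q|)·ϖ·r = ±m·(s·ϖ′·r)`.
Consumers: the C3 roads that read Kato at Kato's curve `E_K` (F-es-18♭K + `KatoCurveExists`, p2's `…ResThreeFlatByName`, es's plus-defect
clause `CuspidalPlusDefectPrimeTo 3`): the transfer `E_K ⇝ E₀` they need is exactly a pair of period ratios prime to `3`; and every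
isogeny of degree prime to `3` is such a pair (`exists_primeToThree_period_ratios_of_isogeny`, Skinner–Urban bookkeeping on both period
lattices' real and imaginary parts — here only the REAL half is available by name in the tree, so §2 records the real half and the odd-χ
half stays a hypothesis of the transfer).

RESULTS (sorry-free): `katoFactThreeAt_of_isIsogenous_of_period_ratios` (§1), `exists_primeToThree_realPeriod_ratio_of_isogeny` (§2).
HONEST FRAMING.  Elementary transfer lemmas; no law is discharged; C3, Manin's conjecture and BSD are NOT proved.  No definitions, no sorry.
-/

set_option autoImplicit false
-- lint-debt: the directory name repeats the summit name (sibling precedent `ManinLocalTwoThreeGammaOneKatoRoad.lean`)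
set_option linter.dupNamespace false

noncomputable section

open scoped Classical MatrixGroups ModularForm
open CongruenceSubgroup WeierstrassCurve Literature.NumberTheory.EllipticCurves
open Literature.NumberTheory.EllipticCurves.ModularForms
open Summit.BirchSwinnertonDyer.Rank1Residual.ManinAdditive
open Summit.BirchSwinnertonDyer.Rank1Residual.ManinAdditive.KatoCurve

namespace Summit.BirchSwinnertonDyer.BirchSwinnertonDyer.Theorems.ManinLocalTwoThree

/-! ## §0 The bookkeeping step shared by both parities -/

/-- Undoing the transport `ϖ′ = ϖ·q/m`: if `s′·ϖ′·r` is an algebraic integer with `3 ∤ s′` and `3 ∤ q`, then `s·ϖ·r` is an algebraic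
integer for `s = s′·|q|`, `3 ∤ s`. [folklore] -/
theorem exists_primeToThree_integral_of_transport (s' : ℕ) (hs' : ¬ 3 ∣ s') (q m : ℤ) (hq : ¬ (3 : ℤ) ∣ q) (hm : m ≠ 0)
    (ϖ : ℚ) (r : ℂ) (hint : IsIntegral ℤ ((s' : ℂ) * ((ϖ * q / m : ℚ) : ℂ) * r)) :
    ∃ s : ℕ, ¬ 3 ∣ s ∧ IsIntegral ℤ ((s : ℂ) * (ϖ : ℂ) * r) := by
  have hq3 : ¬ 3 ∣ q.natAbs := fun h =>
    hq (Int.dvd_natAbs.mp (Int.natCast_dvd_natCast.mpr h))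
  refine ⟨s' * q.natAbs, ?_, ?_⟩
  · intro h
    rcases (Nat.prime_three.dvd_mul.mp h) with h | h
    · exact hs' h
    · exact hq3 h
  · have hm0C : (m : ℂ) ≠ 0 := by exact_mod_cast hm
    have key : ((s' : ℂ) * ((ϖ * q / m : ℚ) : ℂ) * r) * (m : ℂ) = (s' : ℂ) * (q : ℂ) * (ϖ : ℂ) * r := by
      push_cast; field_simp
    have hmZ : IsIntegral ℤ (m : ℂ) := by
      simpa using (isIntegral_algebraMap : IsIntegral ℤ (algebraMap ℤ ℂ m))
    have hint' : IsIntegral ℤ ((s' : ℂ) * (q : ℂ) * (ϖ : ℂ) * r) := by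
      rw [← key]; exact hint.mul hmZ
    have e : ((s' * q.natAbs : ℕ) : ℂ) * (ϖ : ℂ) * r = (s' : ℂ) * ((q.natAbs : ℕ) : ℂ) * (ϖ : ℂ) * r := by
      push_cast; ring
    rw [e]
    have hcast : ((q.natAbs : ℕ) : ℂ) = (((q.natAbs : ℕ) : ℤ) : ℂ) := (Int.cast_natCast _).symm
    rw [hcast]
    rcases le_or_gt 0 q with hq' | hq'
    · rw [Int.natAbs_of_nonneg hq']; exact hint'
    · rw [Int.ofNat_natAbs_of_nonpos hq'.le, Int.cast_neg]
      convert hint'.neg using 1; ring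

/-! ## §1 The transfer -/

/-- **Kato–Néron integrality at `3` is monotone in the `3`-adic size of both Néron periods.**  `V, V′` globally minimal and isogenous,
`9 ∣ N`; if `q·Ω⁺(V′) = m·Ω⁺(V)` and `q′·Ω⁻(V′) = m′·Ω⁻(V)` with `3 ∤ q`, `3 ∤ q′`, then `KatoFactThreeAt V′ f → KatoFactThreeAt V f`
(newform, Euler factors and additivity at `3` shared: `IsNewformOf.of_isIsogenous`, `additive_of_sq_dvd_level`; each parity transported by
§0). [cite: Kato2004Asterisque, Thm. 12.6 (2) (p. 222) (shape of the integrality statement)] -/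
theorem katoFactThreeAt_of_isIsogenous_of_period_ratios (V V' : WeierstrassCurve ℚ) [V.IsElliptic] [V.IsGloballyMinimal]
    [V'.IsElliptic] [V'.IsGloballyMinimal] {N : ℕ} [NeZero N] (f : CuspForm (Gamma0 N) 2) (h9 : 3 ^ 2 ∣ N)
    (hiso : WeierstrassCurve.IsIsogenous V' V) (q m q' m' : ℤ) (hq : ¬ (3 : ℤ) ∣ q) (hq' : ¬ (3 : ℤ) ∣ q')
    (hΩ : (q : ℝ) * V'.realPeriodRat = (m : ℝ) * V.realPeriodRat)
    (hΩ' : (q' : ℝ) * V'.imaginaryPeriodRat = (m' : ℝ) * V.imaginaryPeriodRat)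
    (hK : KatoFactThreeAt V' f) : KatoFactThreeAt V f := by
  haveI : Fact (Nat.Prime 3) := ⟨Nat.prime_three⟩
  intro hf hg hmu M _ hcop χ hprim h1 hord h3 h3' ϖ r
  -- the newform and the additivity are shared
  have hf' : IsNewformOf V' f := hf.of_isIsogenous hiso
  obtain ⟨hg', hmu'⟩ := additive_of_sq_dvd_level 3 V' f hf' h9
  -- the Euler factors are shared
  have hL : ∀ ℓ : ℕ, ((V'.LFunction ℓ : ℤ) : ℂ) = ((V.LFunction ℓ : ℤ) : ℂ) := fun ℓ ↦ by
    rw [← hf'.2 ℓ, hf.2 ℓ]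
  -- `q, q' ≠ 0`, hence `m, m' ≠ 0` (periods are positive)
  have hq0 : q ≠ 0 := by rintro rfl; exact hq (dvd_zero 3)
  have hq'0 : q' ≠ 0 := by rintro rfl; exact hq' (dvd_zero 3)
  have hm0 : m ≠ 0 := by
    rintro rfl
    have : (q : ℝ) * V'.realPeriodRat = 0 := by rw [hΩ]; push_cast; ring
    rcases mul_eq_zero.mp this with h | h
    · exact hq0 (by exact_mod_cast h)
    · exact (KatoCurve.realPeriodRat_pos V').ne' h
  have hm'0 : m' ≠ 0 := by
    rintro rfl
    have : (q' : ℝ) * V'.imaginaryPeriodRat = 0 := by rw [hΩ']; push_cast; ring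
    rcases mul_eq_zero.mp this with h | h
    · exact hq'0 (by exact_mod_cast h)
    · exact (V'.imaginaryPeriodRat_pos).ne' h
  have hKV := hK hf' hg' hmu' M hcop χ hprim h1 hord h3 h3'
  refine ⟨fun heven hϖ hr => ?_, fun hodd hϖ hr => ?_⟩
  · -- EVEN χ: transport along the real periods
    set ϖ₁ : ℚ := ϖ * q / m with hϖ₁def
    have hϖ₁ : (ϖ₁ : ℝ) * V'.realPeriodRat = plusPeriod f := by
      have hm0R : (m : ℝ) ≠ 0 := by exact_mod_cast hm0
      have e : (ϖ₁ : ℝ) * V'.realPeriodRat = (ϖ : ℝ) * ((q : ℝ) * V'.realPeriodRat) / m := by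
        rw [hϖ₁def]; push_cast; field_simp
      rw [e, hΩ, ← hϖ]
      field_simp
    have hr' : (∏ ℓ ∈ N.primeFactors with ¬ ℓ ^ 2 ∣ N,
        (((ℓ : ℂ) - (V'.LFunction ℓ : ℂ) * χ (ℓ : ZMod M)) *
          ((ℓ : ℂ) - (V'.LFunction ℓ : ℂ) * (χ (ℓ : ZMod M))⁻¹))) * twistedSymbolSum f χ =
        r * (plusPeriod f : ℂ) := by
      simp_rw [hL]; exact hr
    obtain ⟨s', hs', hint⟩ := (hKV ϖ₁ r).1 heven hϖ₁ hr'
    exact exists_primeToThree_integral_of_transport s' hs' q m hq hm0 ϖ r (by rw [← hϖ₁def]; exact hint)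
  · -- ODD χ: transport along the imaginary periods
    set ϖ₁ : ℚ := ϖ * q' / m' with hϖ₁def
    have hϖ₁ : (ϖ₁ : ℝ) * V'.imaginaryPeriodRat = minusPeriod f := by
      have hm0R : (m' : ℝ) ≠ 0 := by exact_mod_cast hm'0
      have e : (ϖ₁ : ℝ) * V'.imaginaryPeriodRat = (ϖ : ℝ) * ((q' : ℝ) * V'.imaginaryPeriodRat) / m' := by
        rw [hϖ₁def]; push_cast; field_simp
      rw [e, hΩ', ← hϖ]
      field_simp
    have hr' : (∏ ℓ ∈ N.primeFactors with ¬ ℓ ^ 2 ∣ N,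
        (((ℓ : ℂ) - (V'.LFunction ℓ : ℂ) * χ (ℓ : ZMod M)) *
          ((ℓ : ℂ) - (V'.LFunction ℓ : ℂ) * (χ (ℓ : ZMod M))⁻¹))) * twistedSymbolSum f χ =
        r * (minusPeriod f : ℂ) * Complex.I := by
      simp_rw [hL]; exact hr
    obtain ⟨s', hs', hint⟩ := (hKV ϖ₁ r).2 hodd hϖ₁ hr'
    exact exists_primeToThree_integral_of_transport s' hs' q' m' hq' hm'0 ϖ r (by rw [← hϖ₁def]; exact hint)

/-! ## §2 Isogenies of degree prime to `3` are period-prime-to-`3` on the REAL period (Skinner–Urban bookkeeping) -/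

/-- **An isogeny of degree prime to `3` scales the REAL period by a ratio prime to `3`**: for globally minimal `V′, V` in the class of a
newform `f` and `ψ : V′ → V` with `3 ∤ deg ψ`, `q·Ω⁺(V′) = a·Ω⁺(V)` with `3 ∤ q`, `3 ∤ a`
(`SkinnerUrban2014.exists_int_mul_realPeriodRat_eq_of_isogeny`: `q ∣ deg ψ`, `ab = deg ψ`).  (The imaginary-period half is not available
by name in the tree and is left to the consumer.) [cite: SilvermanAEC2009, Thm. VI.4.1(b) (periods under isogeny; shape only)] -/
theorem exists_primeToThree_realPeriod_ratio_of_isogeny (V V' : WeierstrassCurve ℚ) [V.IsElliptic] [V.IsGloballyMinimal]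
    [V'.IsElliptic] [V'.IsGloballyMinimal] {N : ℕ} [NeZero N] (f : CuspForm (Gamma0 N) 2) (hf : IsNewformOf V f)
    (ψ : Isogeny V' V) (h3 : ¬ 3 ∣ ψ.degree) :
    ∃ q a : ℤ, ¬ (3 : ℤ) ∣ q ∧ ¬ (3 : ℤ) ∣ a ∧ (q : ℝ) * V'.realPeriodRat = (a : ℝ) * V.realPeriodRat := by
  have hiso : WeierstrassCurve.IsIsogenous V' V := ⟨ψ⟩
  have hf' : IsNewformOf V' f := hf.of_isIsogenous hiso
  obtain ⟨D⟩ := Literature.NumberTheory.Automorphic.nonempty_modularParametrizationData_of_isNewformOf hf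
  obtain ⟨D'⟩ := Literature.NumberTheory.Automorphic.nonempty_modularParametrizationData_of_isNewformOf hf'
  obtain ⟨q, a, b, hq0, hqd, hab, hqa⟩ := SkinnerUrban2014.exists_int_mul_realPeriodRat_eq_of_isogeny D' D ψ
  have h3d : ¬ (3 : ℤ) ∣ (ψ.degree : ℤ) := fun h => h3 (by exact_mod_cast h)
  refine ⟨q, a, fun h => h3d (dvd_trans h hqd), fun h => h3d (dvd_trans h ⟨b, hab.symm⟩), hqa⟩

end Summit.BirchSwinnertonDyer.BirchSwinnertonDyer.Theorems.ManinLocalTwoThree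

end
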